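import Summits.KontsevichZagierPeriods.Zeta5Search.TwoTaleP15Inclusion
import Summits.KontsevichZagierPeriods.Zeta5Search.TwoTaleRungAInclusion
import Summits.KontsevichZagierPeriods.Zeta5Search.TwoTaleWhippleDischarged
import Summits.KontsevichZagierPeriods.Zeta5Search.Denom.TwoTaleP15DecayHolds

/-!
# The two-tale point P15: end-to-end, modulo the `p`-coincidence alone

HONEST FRAMING: systematic search; no irrationality claim unless certified.  NOTHING about `ζ(2)` is certified here:
the main statement is an IMPLICATION whose single hypothesis — the `p`-half of Zudilin's two-tale coincidence
(bmiss)@P15, `p_n = −p̂_n` for all `n ≥ 1` — is NOT a tree theorem (verified outside the kernel by fam-tele's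
recurrence certificates; in print it was stated as part of a conjectural Barnes-integral identity, [Zudilin2014ZetaTwo, §5],
and is PROVED IN PRINT by [Marcovecchio2020, Thm 3.7]; in the tree it has since become the kernel theorem
`TwoTaleOmega.pCoincidence_P15` (file `TwoTaleOmega/OmegaBmiss.lean`) (cert-2, independent formalisation), which makes this file's route unconditional).

Cell pub-zeta5 (P1 g9), assembling what the cell proved in the kernel on 2026-08-21:
* fam-measure: Whipple's nearly-poised transformation and `whippleP15_holds` (`q_n = −q̂_n`), `coeffRate_holds`,
  `zetaTwo_exponent_le_P15 : Inclusion → Decay 29.10787 → μ(ζ(2)) ≤ 5.0499 ∧ …` (`TwoTaleWhippleDischarged`);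
* fam-denom: forms, saving product (`15.98084 ≤ ∫φ̃dψ`), line representation, strip shift, line profile, the kernel
  interval certificate `profile_le`, and **`decay_holds_sharp : Decay 29.10787`** (`Denom/TwoTaleP15DecayHolds`, through
  this seat's `decay_of_certificate`);
* this seat: Zudilin's Lemma 7/8 arithmetic on all 20 digit intervals and `inclusion_of_whipple` (`TwoTaleP15Inclusion`),
  the line-bound bricks, and rung A's `inclusionA_holds`.

Results:
* `inclusion_of_pCoincidence : (∀ n ≥ 1, p_n = −p̂_n) → Denom.TwoTaleP15Forms.Inclusion`;
* **`zetaTwo_exponent_le_of_pCoincidence : (∀ n ≥ 1, p_n = −p̂_n) → ExponentLE (zetaValue 2) 5.0499 ∧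
  Zudilin2014.zetaTwo_irrationalityExponent_le`** — Zudilin's 2014 record `μ(ζ(2)) ≤ 5.0954…` improved to `5.0499`,
  CONDITIONAL on that one identity;
* rung A: `zetaTwo_exponent_le_A_of_decay : DecayA 13.229 → ExponentLE (zetaValue 2) 5.2053` (all other rung-A inputs
  are tree theorems; `DecayA` is open).
-/

noncomputable section

namespace Summit.KontsevichZagierPeriods.Zeta5Search.TwoTaleP15

open Literature.NumberTheory.Irrationality.Zudilin2014
open Literature.NumberTheory.Transcendental (zetaValue)

/-- **I1 from the `p`-coincidence alone**: `(∀ n ≥ 1, p_n = −p̂_n) → Inclusion` (the `q`-half is Whipple's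
transformation, PROVED by fam-measure: `TwoTaleWhipple.whippleP15_holds`). -/
theorem inclusion_of_pCoincidence
    (hP : ∀ n : ℕ, 1 ≤ n → formP (aP15 n) (bP15 n) = -formPT (aT n) (bT n)) :
    Denom.TwoTaleP15Forms.Inclusion :=
  inclusion_of_whipple TwoTaleWhipple.whippleP15_holds hP

/-- **P15 end-to-end, ONE input**: the `p`-half of the two-tale coincidence gives `μ(ζ(2)) ≤ 5.0499 < 5.0954` and the
tree's record statement `Zudilin2014.zetaTwo_irrationalityExponent_le` — an IMPLICATION (Whipple, the decay
`Decay 29.10787`, the coefficient rate, the saving rate and the arithmetic are all tree theorems; `p_n = −p̂_n` is not). -/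
theorem zetaTwo_exponent_le_of_pCoincidence
    (hP : ∀ n : ℕ, 1 ≤ n → formP (aP15 n) (bP15 n) = -formPT (aT n) (bT n)) :
    ExponentLE (zetaValue 2) 5.0499 ∧ zetaTwo_irrationalityExponent_le :=
  TwoTaleWhipple.zetaTwo_exponent_le_P15 (inclusion_of_pCoincidence hP) Denom.TwoTaleP15DecayHolds.decay_holds_sharp

/-- **Rung A with one input**: `DecayA 13.229 → μ(ζ(2)) ≤ 5.2053` (`InclusionA` = `inclusionA_holds`, `WhippleA` and
`CoeffRateA` = fam-measure's theorems). -/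
theorem zetaTwo_exponent_le_A_of_decay (hD : Denom.TwoTaleR3Forms.DecayA 13.229) : ExponentLE (zetaValue 2) 5.2053 :=
  TwoTaleWhipple.zetaTwo_exponent_le_A TwoTaleRungA.inclusionA_holds hD

end Summit.KontsevichZagierPeriods.Zeta5Search.TwoTaleP15

end
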